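import Summits.CriticalPhenomena.Ising3DConformalLimit.Theses.LatticeSDPCertificates
import Summits.CriticalPhenomena.Ising3DConformalLimit.Theorems.LatticeSDPCertificatesCertifiedWindowOneStep
import Literature.Probability.LatticeModels.LatticeBootstrapFeasible
import Literature.Probability.LatticeModels.PointwiseScalingLimitEtaExists
import HarnessLib

/-!
# Route `LatticeSDPCertificates`, crux `CertifiedWindow` (stmt-CriticalPhenomena-5504):
# the glue `BulkWindow ⊕ BoundaryScaleStability ⇒ CertifiedWindow` (line `registered`/`birth`, rev 2)

The composition of the lead's rev-2 skeleton for the crux, landed in HYPOTHESIS FORM so that the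
two research-level stubs can be pursued (or promoted to items) independently of the skeleton
workfile `Cruxes/CertifiedWindow/Lines/birth.lean`:

* `oneStep_transfer` — real arithmetic at one pair of scales: bulk `c q^{-(3/2-e)} G(n) ≤ G(qn)`,
  boundary stability `G(qn) E(n) ≤ K q^{e/2} G(n) E(qn)`, `G(n) > 0`, `K > 0`, `E(n) ≥ 0` give
  `(c/K) q^{-(3/2-e/2)} E(n) ≤ E(qn)`.
* `exists_good_scaleFactor` — for `a, e > 0` an integer `q ≥ 2` with `a q^{-(3/2-e)} > q^{-3/2}`.
* `oneStepHyp_of_bulk_of_scaleStability` (= registered stub `stub_glueToOneStep`, discharged BY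
  NAME here) and `certifiedWindow_of_bulk_of_scaleStability` — **BULK WINDOW (`WindowBelowHalf`, item 5507,
  with constants `(ε₁, c₁)`) and ONE-SCALE-FACTOR BOUNDARY STABILITY with loss exponent `ε₁/2`
  (for all window constants: a constant `K`, and for every scale factor `q ≥ 2` a relative depth
  `k`, such that every row-feasible level-`L ≥ kR` boundary-law functional has
  `G(qn e₁) E{0,n e₁} ≤ K q^{ε₁/2} G(n e₁) E{0,qn e₁}` for `qn ≤ R`) imply `CertifiedWindow`**:
  choose `q` with `(c₁/K) q^{ε₁/2} > 1`, work at relative depth `k q`, divide by `G(n e₁) > 0`,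
  and feed the one-step criterion `certifiedWindow_of_oneStep`.
* `certifiedWindow_of_windowBelowHalf_of_scaleStability` — the same with the bulk input written as
  the route decl `WindowBelowHalf` and the boundary input in its `∀ δ > 0` form (the rev-2 stub
  `stub_boundaryScaleStability` verbatim).
* `scaleStability_of_ratioStability` — the planner's rev-1 boundary stub (ratio stability on all
  pairs `m ≤ n ≤ R`, loss `K (n/m)^δ`, depth independent of the factor) implies the rev-2 one:
  the reshape only weakens what the line asks of the boundary.

Helper file (`--supports stmt-CriticalPhenomena-5504`); nothing here proves or refutes the crux or
either stub. References: Messager–Miracle-Solé 1977 [MessagerMiracleSoleJSP1977] (monotonicity,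
inside `certifiedWindow_of_oneStep`); the glue is elementary [folklore].
-/

noncomputable section

namespace Summit.CriticalPhenomena.Ising3DConformalLimit.Theorems

open Literature.Probability.LatticeModels MeasureTheory
open Summit.CriticalPhenomena.Ising3DConformalLimit.Theses.LatticeSDPCertificates

/-- Real arithmetic of the composition at one pair of scales: bulk `c x^{-(3/2-e)} Gn ≤ Gq`,
stability `Gq En ≤ K x^{e/2} Gn Eq`, `Gn > 0`, `K > 0`, `En ≥ 0` give
`(c/K) x^{-(3/2-e/2)} En ≤ Eq`. [folklore] -/
theorem oneStep_transfer {c K x e Gn Gq En Eq : ℝ} (hK : 0 < K) (hx : 0 < x)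
    (hGn : 0 < Gn) (hEn : 0 ≤ En)
    (hbulk : c * x ^ (-((3:ℝ) / 2 - e)) * Gn ≤ Gq)
    (hstab : Gq * En ≤ K * x ^ (e / 2) * Gn * Eq) :
    c / K * x ^ (-((3:ℝ) / 2 - e / 2)) * En ≤ Eq := by
  have hxd : 0 < x ^ (e / 2) := Real.rpow_pos_of_pos hx _
  have h1 : c * x ^ (-((3:ℝ) / 2 - e)) * Gn * En ≤ K * x ^ (e / 2) * Gn * Eq :=
    le_trans (mul_le_mul_of_nonneg_right hbulk hEn) hstab
  have h2 : (c * x ^ (-((3:ℝ) / 2 - e)) * En) * Gn ≤ (K * x ^ (e / 2) * Eq) * Gn := by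
    have e1 : (c * x ^ (-((3:ℝ) / 2 - e)) * En) * Gn = c * x ^ (-((3:ℝ) / 2 - e)) * Gn * En := by
      ring
    have e2 : (K * x ^ (e / 2) * Eq) * Gn = K * x ^ (e / 2) * Gn * Eq := by ring
    rw [e1, e2]
    exact h1
  have h3 : c * x ^ (-((3:ℝ) / 2 - e)) * En ≤ K * x ^ (e / 2) * Eq :=
    le_of_mul_le_mul_right h2 hGn
  have hexp : x ^ (-((3:ℝ) / 2 - e / 2)) = x ^ (-((3:ℝ) / 2 - e)) * (x ^ (e / 2))⁻¹ := by
    rw [← Real.rpow_neg hx.le (e / 2), ← Real.rpow_add hx]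
    congr 1
    ring
  have e3 : c / K * (x ^ (-((3:ℝ) / 2 - e)) * (x ^ (e / 2))⁻¹) * En =
      (c * x ^ (-((3:ℝ) / 2 - e)) * En) / (K * x ^ (e / 2)) := by
    field_simp
  rw [hexp, e3, div_le_iff₀ (mul_pos hK hxd)]
  calc c * x ^ (-((3:ℝ) / 2 - e)) * En ≤ K * x ^ (e / 2) * Eq := h3
    _ = Eq * (K * x ^ (e / 2)) := by ring

/-- Choice of the scale factor: for `a, e > 0` there is an integer `q ≥ 2` with `a q^e > 1`, hence
`q^{-3/2} < a q^{-(3/2-e)}`. [folklore] -/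
theorem exists_good_scaleFactor {a e : ℝ} (ha : 0 < a) (he : 0 < e) :
    ∃ q : ℕ, 2 ≤ q ∧ (q : ℝ) ^ (-((3 : ℝ) / 2)) < a * (q : ℝ) ^ (-((3 : ℝ) / 2 - e)) := by
  obtain ⟨q₀, hq₀⟩ := exists_nat_gt (a⁻¹ ^ e⁻¹)
  have hq0 : (0 : ℝ) < ((q₀ + 2 : ℕ) : ℝ) := by positivity
  refine ⟨q₀ + 2, by omega, ?_⟩
  have haq : 1 < a * ((q₀ + 2 : ℕ) : ℝ) ^ e := by
    have hlt : a⁻¹ ^ e⁻¹ < ((q₀ + 2 : ℕ) : ℝ) := hq₀.trans_le (by push_cast; linarith)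
    have h1 : (a⁻¹ ^ e⁻¹) ^ e < ((q₀ + 2 : ℕ) : ℝ) ^ e := Real.rpow_lt_rpow (by positivity) hlt he
    rw [Real.rpow_inv_rpow (by positivity) he.ne'] at h1
    have h2 := mul_lt_mul_of_pos_left h1 ha
    rwa [mul_inv_cancel₀ ha.ne'] at h2
  have hsplit : ((q₀ + 2 : ℕ) : ℝ) ^ (-((3 : ℝ) / 2 - e)) =
      ((q₀ + 2 : ℕ) : ℝ) ^ e * ((q₀ + 2 : ℕ) : ℝ) ^ (-((3 : ℝ) / 2)) := by
    rw [← Real.rpow_add hq0]; congr 1; ring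
  rw [hsplit, ← mul_assoc]
  have hpos : (0 : ℝ) < ((q₀ + 2 : ℕ) : ℝ) ^ (-((3 : ℝ) / 2)) := Real.rpow_pos_of_pos hq0 _
  calc ((q₀ + 2 : ℕ) : ℝ) ^ (-((3 : ℝ) / 2))
      = 1 * ((q₀ + 2 : ℕ) : ℝ) ^ (-((3 : ℝ) / 2)) := (one_mul _).symm
    _ < a * ((q₀ + 2 : ℕ) : ℝ) ^ e * ((q₀ + 2 : ℕ) : ℝ) ^ (-((3 : ℝ) / 2)) :=
        mul_lt_mul_of_pos_right haq hpos

/-- **The glue of the rev-2 skeleton: bulk WINDOW and one-scale-factor boundary stability give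
the one-step criterion.** From bulk `(ε₁, c₁)` and the boundary constant `K` (loss exponent
`ε₁/2`; for every `q` a depth `k`): choose `q ≥ 2` with `(c₁/K) q^{ε₁/2} > 1`, put
`κ := (c₁/K) q^{-(3/2-ε₁/2)} > q^{-3/2}` and the depth `k q ≥ q`; at level `k q R = k (q R)` the
boundary input compares `n` with `q n ≤ q R`, and `c₁ q^{-(3/2-ε₁)} G(n) E(n) ≤ G(qn) E(n) ≤
K q^{ε₁/2} G(n) E(qn)` gives `κ E(n) ≤ E(qn)` after dividing by `G(n e₁) > 0`. [folklore] -/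
theorem oneStepHyp_of_bulk_of_scaleStability {ε₁ c₁ : ℝ} (hε₁ : 0 < ε₁) (hc₁ : 0 < c₁)
    (hwin : ∀ m n : ℕ, 1 ≤ m → m ≤ n → c₁ * ((n : ℝ) / m) ^ (-((3:ℝ) / 2 - ε₁)) *
      criticalTwoPoint 3 (Pi.single 0 (m : ℤ)) ≤ criticalTwoPoint 3 (Pi.single 0 (n : ℤ)))
    (hst : ∀ cw Cw : ℝ, 0 < cw → 0 < Cw → ∃ K : ℝ, 0 < K ∧ ∀ q : ℕ, 2 ≤ q → ∃ k : ℕ, 1 ≤ k ∧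
      ∀ (L R : ℕ) (ν : Measure (SpinConfig (Site 3))), k * R ≤ L → IsProbabilityMeasure ν →
        LatticeBootstrapFeasible L cw Cw (boundaryLawFunctional 3 L (criticalBeta 3) ν) →
        ∀ n : ℕ, 1 ≤ n → q * n ≤ R →
          criticalTwoPoint 3 (Pi.single 0 ((q * n : ℕ) : ℤ)) *
              boundaryLawFunctional 3 L (criticalBeta 3) ν {0, Pi.single 0 (n : ℤ)} ≤
            K * (q : ℝ) ^ (ε₁ / 2) * criticalTwoPoint 3 (Pi.single 0 (n : ℤ)) *
              boundaryLawFunctional 3 L (criticalBeta 3) ν {0, Pi.single 0 ((q * n : ℕ) : ℤ)}) :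
    ∀ cw Cw : ℝ, 0 < cw → 0 < Cw → ∃ (q : ℕ) (κ : ℝ) (k : ℕ), 2 ≤ q ∧
      (q : ℝ) ^ (-((3 : ℝ) / 2)) < κ ∧ q ≤ k ∧
      ∀ (R : ℕ) (ν : Measure (SpinConfig (Site 3))), IsProbabilityMeasure ν →
        LatticeBootstrapFeasible (k * R) cw Cw
          (boundaryLawFunctional 3 (k * R) (criticalBeta 3) ν) →
        ∀ n : ℕ, 1 ≤ n → n ≤ R →
          κ * boundaryLawFunctional 3 (k * R) (criticalBeta 3) ν {0, Pi.single 0 (n : ℤ)} ≤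
            boundaryLawFunctional 3 (k * R) (criticalBeta 3) ν
              {0, Pi.single 0 ((q * n : ℕ) : ℤ)} := by
  intro cw Cw hcw hCw
  obtain ⟨K, hK, hKq⟩ := hst cw Cw hcw hCw
  obtain ⟨q, hq, hqκ⟩ := exists_good_scaleFactor (div_pos hc₁ hK) (half_pos hε₁)
  obtain ⟨k, hk, hstab⟩ := hKq q hq
  refine ⟨q, c₁ / K * (q : ℝ) ^ (-((3 : ℝ) / 2 - ε₁ / 2)), k * q, hq, hqκ,
    Nat.le_mul_of_pos_left q hk, ?_⟩
  intro R ν hν hfeas n hn hnR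
  -- level `k q R = k (q R)`: the boundary input at `(L, R') = (k q R, q R)`, pair `(n, q n)`
  have hL : k * (q * R) ≤ k * q * R := (mul_assoc k q R).symm.le
  have hqn : q * n ≤ q * R := Nat.mul_le_mul_left q hnR
  have hst1 := hstab (k * q * R) (q * R) ν hL hν hfeas n hn hqn
  have hq0 : (0 : ℝ) < q := by exact_mod_cast (show 0 < q by omega)
  have hGn : 0 < criticalTwoPoint 3 (Pi.single 0 (n : ℤ)) := criticalTwoPoint_axis_pos n
  have hnL : n ≤ k * q * R :=
    hnR.trans (Nat.le_mul_of_pos_left R (Nat.mul_pos (by omega) (by omega)))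
  have hEn : 0 ≤ boundaryLawFunctional 3 (k * q * R) (criticalBeta 3) ν {0, Pi.single 0 (n : ℤ)} :=
    (feasible_axis_pos hfeas hcw hn hnL).le
  have hbulk : c₁ * (q : ℝ) ^ (-((3:ℝ) / 2 - ε₁)) * criticalTwoPoint 3 (Pi.single 0 (n : ℤ)) ≤
      criticalTwoPoint 3 (Pi.single 0 ((q * n : ℕ) : ℤ)) := by
    have key := hwin n (q * n) hn (Nat.le_mul_of_pos_left n (by omega))
    have hn0 : (n : ℝ) ≠ 0 := by exact_mod_cast (show n ≠ 0 by omega)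
    have hdiv : (((q * n : ℕ) : ℝ)) / n = (q : ℝ) := by push_cast; field_simp
    rwa [hdiv] at key
  exact oneStep_transfer hK hq0 hGn hEn hbulk hst1

/-- **Registered stub `stub_glueToOneStep` of the rev-2 skeleton of crux `CertifiedWindow`**
(line `registered` = `Cruxes/CertifiedWindow/Lines/birth.lean`), verbatim the registered
signature; proof = `oneStepHyp_of_bulk_of_scaleStability`. [folklore] -/
theorem stub_glueToOneStep : ∀ ε₁ c₁ : ℝ, 0 < ε₁ → 0 < c₁ → (∀ m n : ℕ, 1 ≤ m → m ≤ n → c₁ * ((n : ℝ) / m) ^ (-((3:ℝ) / 2 - ε₁)) * Literature.Probability.LatticeModels.criticalTwoPoint 3 (Pi.single 0 (m : ℤ)) ≤ Literature.Probability.LatticeModels.criticalTwoPoint 3 (Pi.single 0 (n : ℤ))) → (∀ cw Cw : ℝ, 0 < cw → 0 < Cw → ∃ K : ℝ, 0 < K ∧ ∀ q : ℕ, 2 ≤ q → ∃ k : ℕ, 1 ≤ k ∧ ∀ (L R : ℕ) (ν : MeasureTheory.Measure (Literature.Probability.LatticeModels.SpinConfig (Literature.Probability.LatticeModels.Site 3))),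 k * R ≤ L → MeasureTheory.IsProbabilityMeasure ν → Literature.Probability.LatticeModels.LatticeBootstrapFeasible L cw Cw (Literature.Probability.LatticeModels.boundaryLawFunctional 3 L (Literature.Probability.LatticeModels.criticalBeta 3) ν) → ∀ n : ℕ, 1 ≤ n → q * n ≤ R → Literature.Probability.LatticeModels.criticalTwoPoint 3 (Pi.single 0 ((q * n : ℕ) : ℤ)) * Literature.Probability.LatticeModels.boundaryLawFunctional 3 L (Literature.Probability.LatticeModels.criticalBeta 3) ν {0, Pi.single 0 (n : ℤ)} ≤ K * (q : ℝ) ^ (ε₁ / 2) * Literature.Probability.LatticeModels.criticalTwoPoint 3 (Pi.single 0 (n : ℤ)) * Literature.Probability.LatticeModels.boundaryLawFunctional 3 L (Literature.Probability.LatticeModels.criticalBeta 3) ν {0, Pi.single 0 ((q * n : ℕ) : ℤ)}) → ∀ cw Cw : ℝ, 0 < cw → 0 < Cw → ∃ (q : ℕ) (κ : ℝ) (k : ℕ), 2 ≤ q ∧ (q : ℝ) ^ (-((3 : ℝ) / 2)) < κ ∧ q ≤ k ∧ ∀ (R : ℕ) (ν : MeasureTheory.Measure (Literature.Probability.LatticeModels.SpinConfig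 (Literature.Probability.LatticeModels.Site 3))), MeasureTheory.IsProbabilityMeasure ν → Literature.Probability.LatticeModels.LatticeBootstrapFeasible (k * R) cw Cw (Literature.Probability.LatticeModels.boundaryLawFunctional 3 (k * R) (Literature.Probability.LatticeModels.criticalBeta 3) ν) → ∀ n : ℕ, 1 ≤ n → n ≤ R → κ * Literature.Probability.LatticeModels.boundaryLawFunctional 3 (k * R) (Literature.Probability.LatticeModels.criticalBeta 3) ν {0, Pi.single 0 (n : ℤ)} ≤ Literature.Probability.LatticeModels.boundaryLawFunctional 3 (k * R) (Literature.Probability.LatticeModels.criticalBeta 3) ν {0, Pi.single 0 ((q * n : ℕ) : ℤ)} :=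
  fun _ _ hε₁ hc₁ hwin hst => oneStepHyp_of_bulk_of_scaleStability hε₁ hc₁ hwin hst

/-- **Bulk WINDOW and one-scale-factor boundary stability give `CertifiedWindow`**
(`certifiedWindow_of_oneStep` after the glue). [folklore] -/
theorem certifiedWindow_of_bulk_of_scaleStability {ε₁ c₁ : ℝ} (hε₁ : 0 < ε₁) (hc₁ : 0 < c₁)
    (hwin : ∀ m n : ℕ, 1 ≤ m → m ≤ n → c₁ * ((n : ℝ) / m) ^ (-((3:ℝ) / 2 - ε₁)) *
      criticalTwoPoint 3 (Pi.single 0 (m : ℤ)) ≤ criticalTwoPoint 3 (Pi.single 0 (n : ℤ)))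
    (hst : ∀ cw Cw : ℝ, 0 < cw → 0 < Cw → ∃ K : ℝ, 0 < K ∧ ∀ q : ℕ, 2 ≤ q → ∃ k : ℕ, 1 ≤ k ∧
      ∀ (L R : ℕ) (ν : Measure (SpinConfig (Site 3))), k * R ≤ L → IsProbabilityMeasure ν →
        LatticeBootstrapFeasible L cw Cw (boundaryLawFunctional 3 L (criticalBeta 3) ν) →
        ∀ n : ℕ, 1 ≤ n → q * n ≤ R →
          criticalTwoPoint 3 (Pi.single 0 ((q * n : ℕ) : ℤ)) *
              boundaryLawFunctional 3 L (criticalBeta 3) ν {0, Pi.single 0 (n : ℤ)} ≤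
            K * (q : ℝ) ^ (ε₁ / 2) * criticalTwoPoint 3 (Pi.single 0 (n : ℤ)) *
              boundaryLawFunctional 3 L (criticalBeta 3) ν {0, Pi.single 0 ((q * n : ℕ) : ℤ)}) :
    CertifiedWindow :=
  certifiedWindow_of_oneStep (oneStepHyp_of_bulk_of_scaleStability hε₁ hc₁ hwin hst)

/-- **The same glue with the route's own vocabulary**: `WindowBelowHalf` (item 5507) and the
rev-2 boundary stub in its `∀ δ > 0` form (`stub_boundaryScaleStability` of the skeleton, verbatim)
imply `CertifiedWindow` (instantiate the boundary input at `δ := ε₁/2`). [folklore] -/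
theorem certifiedWindow_of_windowBelowHalf_of_scaleStability (hW : WindowBelowHalf)
    (hS : ∀ cw Cw : ℝ, 0 < cw → 0 < Cw → ∀ δ : ℝ, 0 < δ → ∃ K : ℝ, 0 < K ∧ ∀ q : ℕ, 2 ≤ q →
      ∃ k : ℕ, 1 ≤ k ∧ ∀ (L R : ℕ) (ν : Measure (SpinConfig (Site 3))), k * R ≤ L →
        IsProbabilityMeasure ν →
        LatticeBootstrapFeasible L cw Cw (boundaryLawFunctional 3 L (criticalBeta 3) ν) →
        ∀ n : ℕ, 1 ≤ n → q * n ≤ R →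
          criticalTwoPoint 3 (Pi.single 0 ((q * n : ℕ) : ℤ)) *
              boundaryLawFunctional 3 L (criticalBeta 3) ν {0, Pi.single 0 (n : ℤ)} ≤
            K * (q : ℝ) ^ δ * criticalTwoPoint 3 (Pi.single 0 (n : ℤ)) *
              boundaryLawFunctional 3 L (criticalBeta 3) ν {0, Pi.single 0 ((q * n : ℕ) : ℤ)}) :
    CertifiedWindow := by
  obtain ⟨ε₁, c₁, hε₁, hc₁, hwin⟩ := hW
  exact certifiedWindow_of_bulk_of_scaleStability hε₁ hc₁ hwin
    fun cw Cw hcw hCw => hS cw Cw hcw hCw (ε₁ / 2) (half_pos hε₁)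

/-- **Rev 1 ⇒ rev 2 for the boundary stub**: ratio stability on all pairs `1 ≤ m ≤ n ≤ R` with
loss `K (n/m)^δ` at a depth independent of the scale factor (the planner's
`stub_boundaryRatioStability`) implies one-scale-factor stability (specialise `(m, n) := (n, qn)`).
[folklore] -/
theorem scaleStability_of_ratioStability
    (h : ∀ cw Cw : ℝ, 0 < cw → 0 < Cw → ∀ δ : ℝ, 0 < δ → ∃ (K : ℝ) (k : ℕ), 0 < K ∧ 1 ≤ k ∧
      ∀ (L R : ℕ) (ν : Measure (SpinConfig (Site 3))), k * R ≤ L → IsProbabilityMeasure ν →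
        LatticeBootstrapFeasible L cw Cw (boundaryLawFunctional 3 L (criticalBeta 3) ν) →
        ∀ m n : ℕ, 1 ≤ m → m ≤ n → n ≤ R →
          criticalTwoPoint 3 (Pi.single 0 (n : ℤ)) *
              boundaryLawFunctional 3 L (criticalBeta 3) ν {0, Pi.single 0 (m : ℤ)} ≤
            K * ((n : ℝ) / m) ^ δ * criticalTwoPoint 3 (Pi.single 0 (m : ℤ)) *
              boundaryLawFunctional 3 L (criticalBeta 3) ν {0, Pi.single 0 (n : ℤ)}) :
    ∀ cw Cw : ℝ, 0 < cw → 0 < Cw → ∀ δ : ℝ, 0 < δ → ∃ K : ℝ, 0 < K ∧ ∀ q : ℕ, 2 ≤ q →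
      ∃ k : ℕ, 1 ≤ k ∧ ∀ (L R : ℕ) (ν : Measure (SpinConfig (Site 3))), k * R ≤ L →
        IsProbabilityMeasure ν →
        LatticeBootstrapFeasible L cw Cw (boundaryLawFunctional 3 L (criticalBeta 3) ν) →
        ∀ n : ℕ, 1 ≤ n → q * n ≤ R →
          criticalTwoPoint 3 (Pi.single 0 ((q * n : ℕ) : ℤ)) *
              boundaryLawFunctional 3 L (criticalBeta 3) ν {0, Pi.single 0 (n : ℤ)} ≤
            K * (q : ℝ) ^ δ * criticalTwoPoint 3 (Pi.single 0 (n : ℤ)) *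
              boundaryLawFunctional 3 L (criticalBeta 3) ν {0, Pi.single 0 ((q * n : ℕ) : ℤ)} := by
  intro cw Cw hcw hCw δ hδ
  obtain ⟨K, k, hK, hk, hst⟩ := h cw Cw hcw hCw δ hδ
  refine ⟨K, hK, fun q hq => ⟨k, hk, fun L R ν hL hν hfeas n hn hqn => ?_⟩⟩
  have key := hst L R ν hL hν hfeas n (q * n) hn (Nat.le_mul_of_pos_left n (by omega)) hqn
  have hn0 : (n : ℝ) ≠ 0 := by exact_mod_cast (show n ≠ 0 by omega)
  have hdiv : (((q * n : ℕ) : ℝ)) / n = (q : ℝ) := by push_cast; field_simp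
  rwa [hdiv] at key

/-- **The rev-1 skeleton's reading, landed**: `WindowBelowHalf` and the planner's rev-1 boundary
stub (`stub_boundaryRatioStability`, verbatim) imply `CertifiedWindow`. [folklore] -/
theorem certifiedWindow_of_windowBelowHalf_of_ratioStability (hW : WindowBelowHalf)
    (hS : ∀ cw Cw : ℝ, 0 < cw → 0 < Cw → ∀ δ : ℝ, 0 < δ → ∃ (K : ℝ) (k : ℕ), 0 < K ∧ 1 ≤ k ∧
      ∀ (L R : ℕ) (ν : Measure (SpinConfig (Site 3))), k * R ≤ L → IsProbabilityMeasure ν →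
        LatticeBootstrapFeasible L cw Cw (boundaryLawFunctional 3 L (criticalBeta 3) ν) →
        ∀ m n : ℕ, 1 ≤ m → m ≤ n → n ≤ R →
          criticalTwoPoint 3 (Pi.single 0 (n : ℤ)) *
              boundaryLawFunctional 3 L (criticalBeta 3) ν {0, Pi.single 0 (m : ℤ)} ≤
            K * ((n : ℝ) / m) ^ δ * criticalTwoPoint 3 (Pi.single 0 (m : ℤ)) *
              boundaryLawFunctional 3 L (criticalBeta 3) ν {0, Pi.single 0 (n : ℤ)}) :
    CertifiedWindow :=
  certifiedWindow_of_windowBelowHalf_of_scaleStability hW (scaleStability_of_ratioStability hS)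

end Summit.CriticalPhenomena.Ising3DConformalLimit.Theorems
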